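import Mathlib
import Literature.AlgebraicGeometry.Resolution.AffineBlowupAlgebra

/-! Scratch: the prime of the generic section (worker stub_sectionCriterion). -/

set_option linter.dupNamespace false

open MvPolynomial

namespace Summit.ResolutionOfSingularities.ResolutionOfSingularities.Theorems

-- (the key lemma, copied from KeyLemma.lean for this scratch file)
/-- The coefficient of `X_i^k` in `(Σ_j c_j X_j)^k` is `c_i^k`. [folklore] -/
theorem coeff_single_linearForm_pow {E : Type*} [CommRing E] {ι : Type*} [Fintype ι]
    [DecidableEq ι] (c : ι → E) (i : ι) (k : ℕ) :
    coeff (Finsupp.single i k) ((∑ j, C (c j) * X j) ^ k) = c i ^ k := by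
  induction k with
  | zero => simp
  | succ k ih =>
    rw [pow_succ, Finset.mul_sum, coeff_sum]
    rw [Finset.sum_eq_single i]
    · rw [mul_left_comm, coeff_C_mul, coeff_mul_X', if_pos (by simp),
        show Finsupp.single i (k + 1) - Finsupp.single i 1 = Finsupp.single i k by
          rw [← Finsupp.single_tsub, Nat.add_sub_cancel], ih, pow_succ, mul_comm]
    · intro j _ hj
      rw [mul_left_comm, coeff_C_mul, coeff_mul_X', if_neg, mul_zero]
      rw [Finsupp.mem_support_iff, Finsupp.single_apply, if_neg (Ne.symm hj)]
      exact fun h => h rfl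
    · intro h; exact absurd (Finset.mem_univ i) h

theorem aeval_linearForm_injective {K E : Type*} [CommRing K] [CommRing E] [Algebra K E]
    {ι : Type*} [Fintype ι] [DecidableEq ι] (c : ι → E) (i₁ : ι)
    (hc : Transcendental K (c i₁)) :
    Function.Injective (aeval (R := K)
      (fun o : Option ι => o.elim (∑ j, C (c j) * X j) X) :
        MvPolynomial (Option ι) K → MvPolynomial ι E) := by
  sorry

/-- **The generic member passes through a point above a non-fibre-closed point.** Let `Q` be a
prime of a `K`-algebra `A'` and `u₀ = 1, u₁, …, u_{n+1} ∈ A'` with `u₁` transcendental over `K`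
modulo `Q`. Then the kernel `𝔔₀` of `A'[X₀, …, X_{n+1}] → κ[X₁, …, X_{n+1}]`,
`X₀ ↦ -Σ_{j ≥ 1} ū_j X_j` (`κ = Frac(A'/Q)`), is a prime over `Q` containing the linear form
`Σ_j u_j X_j` and NO nonzero polynomial with coefficients in `K` (key algebra lemma
`aeval_linearForm_injective`): the generic member `Σ t_j u_j = 0` of the linear system, over the
function field `K(t)`, has a point above `Q`. [folklore] -/
theorem exists_prime_genericSection {K A' : Type*} [Field K] [CommRing A'] [Algebra K A']
    (Q : Ideal A') [Q.IsPrime] {n : ℕ} (u : Fin (n + 2) → A') (hu0 : u 0 = 1)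
    (hu1 : Transcendental K (Ideal.Quotient.mk Q (u 1))) :
    ∃ 𝔔₀ : Ideal (MvPolynomial (Fin (n + 2)) A'), 𝔔₀.IsPrime ∧
      𝔔₀.comap (C : A' →+* MvPolynomial (Fin (n + 2)) A') = Q ∧
      (∑ j, X j * C (u j)) ∈ 𝔔₀ ∧
      ∀ f : MvPolynomial (Fin (n + 2)) K, f ≠ 0 → map (algebraMap K A') f ∉ 𝔔₀ := by
  classical
  let ρ : A' →+* (FractionRing (A' ⧸ Q)) := (algebraMap (A' ⧸ Q) (FractionRing (A' ⧸ Q))).comp (Ideal.Quotient.mk Q)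
  have hρ : ∀ a, ρ a = algebraMap (A' ⧸ Q) (FractionRing (A' ⧸ Q)) (Ideal.Quotient.mk Q a) := fun _ => rfl
  obtain ⟨ū, hū⟩ : ∃ ū : Fin (n + 2) → (FractionRing (A' ⧸ Q)), ∀ j, ū j = ρ (u j) := ⟨_, fun _ => rfl⟩
  obtain ⟨c, hc_def⟩ : ∃ c : Fin (n + 1) → (FractionRing (A' ⧸ Q)), ∀ j, c j = -ū j.succ := ⟨_, fun _ => rfl⟩
  let L : MvPolynomial (Fin (n + 1)) (FractionRing (A' ⧸ Q)) := ∑ j, C (c j) * X j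
  let Λ : MvPolynomial (Fin (n + 2)) A' →+* MvPolynomial (Fin (n + 1)) (FractionRing (A' ⧸ Q)) :=
    eval₂Hom (C.comp ρ) (Fin.cases L (fun j => X j))
  have hΛC : ∀ a, Λ (C a) = C (ρ a) := fun a => by simp [Λ]
  have hΛX0 : Λ (X 0) = L := by simp [Λ]
  have hΛXs : ∀ j : Fin (n + 1), Λ (X j.succ) = X j := fun j => by simp [Λ]
  refine ⟨RingHom.ker Λ, RingHom.ker_isPrime Λ, ?_, ?_, ?_⟩
  · ext a
    rw [Ideal.mem_comap, RingHom.mem_ker, hΛC, C_eq_zero, hρ,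
      map_eq_zero_iff _ (IsFractionRing.injective (A' ⧸ Q) (FractionRing (A' ⧸ Q))), Ideal.Quotient.eq_zero_iff_mem]
  · rw [RingHom.mem_ker, map_sum]
    simp only [map_mul, hΛC, ← hū]
    rw [Fin.sum_univ_succ, hΛX0, hū 0, hu0, map_one, map_one, mul_one]
    simp only [hΛXs]
    rw [← Finset.sum_add_distrib]
    refine Finset.sum_eq_zero fun j _ => ?_
    rw [hc_def, map_neg]
    ring
  · -- the key lemma
    intro f hf
    have halg : ∀ k, algebraMap K (FractionRing (A' ⧸ Q)) k = ρ (algebraMap K A' k) := fun k => by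
      rw [IsScalarTower.algebraMap_apply K (A' ⧸ Q) (FractionRing (A' ⧸ Q)), IsScalarTower.algebraMap_apply K A' (A' ⧸ Q)]
      rfl
    have hū1 : Transcendental K (ū 1) := by
      rw [hū 1, hρ]
      exact (transcendental_algebraMap_iff (IsFractionRing.injective (A' ⧸ Q) (FractionRing (A' ⧸ Q)))).mpr hu1
    have hc : Transcendental K (c 0) := by
      intro h
      apply hū1
      have h2 := h.neg
      rw [hc_def, neg_neg, Fin.succ_zero_eq_one] at h2
      exact h2
    have hkey := aeval_linearForm_injective (K := K) c 0 hc
    set ψ := aeval (R := K) (fun o : Option (Fin (n + 1)) => o.elim (∑ j, C (c j) * X j) X) with hψ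
    let ε : Fin (n + 2) ≃ Option (Fin (n + 1)) := finSuccEquiv (n + 1)
    have hcomp : ∀ f : MvPolynomial (Fin (n + 2)) K,
        Λ (map (algebraMap K A') f) = ψ (rename ε f) := by
      intro f
      induction f using MvPolynomial.induction_on with
      | C k => rw [map_C, hΛC, rename_C, hψ, algHom_C, MvPolynomial.algebraMap_apply, halg]
      | add p q hp hq => rw [map_add, map_add, hp, hq, map_add, map_add]
      | mul_X p j hp =>
        rw [map_mul, map_mul, hp, map_X, map_mul, map_mul, rename_X, hψ, aeval_X, ← hψ]
        congr 1
        refine Fin.cases ?_ (fun i => ?_) j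
        · rw [hΛX0, show ε 0 = none from finSuccEquiv_zero]
          rfl
        · rw [hΛXs, show ε i.succ = some i from finSuccEquiv_succ i]
          simp only [Option.elim]
    intro hmem
    rw [RingHom.mem_ker] at hmem
    have h1 : ψ (rename ε f) = 0 := by rw [← hcomp]; exact hmem
    have h2 : rename ε f = 0 := hkey (by rw [h1, map_zero])
    exact hf (rename_injective ε ε.injective (by rw [h2, map_zero]))

end Summit.ResolutionOfSingularities.ResolutionOfSingularities.Theorems
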